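import Mathlib
import Summits.PneNP.PneNP.Theorems.ConvexRankGatesConvexGateBlindRainbowLevel

/-!
# PneNP / ConvexRankGates — `ConvexGateBlind`: the level-`t` rainbow functional is exact one level higher

Helpers (`--supports stmt-PneNP-10680`), addendum to `…RainbowLevel.lean`. The level-`t` functional `rbLt h n t` (clumps of
size `≤ t + 2`, classes of size `n ≥ t + 2`) has the rainbow inclusion numbers not only on sets of size `≤ t` but on ALL sets
of size `≤ t + 1` (`rbLt_indicator_succ`, registered stub `rainbow_marginal_level_succ`; `t + 2 ≤ K`): the vanishing in the
collision case needs `r + #H < t` where `r + #H = #T - 2`, and the two rainbow sums are (`t+1`)- and (`t+2`)-fold differences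
of polynomials of degree `#T - 1 ≤ t` and `#T ≤ t + 1`. (It fails at level `t + 2`: tmp/smallclass numerics.) Consequence
(`…SmallJuntaExact.lean`): `(n-1)`-juntas are blind on a colouring column with classes of size `n ≤ K`, and `n`-juntas (the
class windows) represent it — the locality threshold of a colouring column is EXACTLY its class size. [new]
-/

namespace Summit.PneNP.PneNP.Theorems

open Finset

set_option linter.dupNamespace false

noncomputable section

variable {m K : ℕ}

/-- `∑_{j ≤ t} (-1)^j C(t,j) C(N-j, s) / ((j+1)(j+2)) = C(N+1,s)/(t+1) - C(N+2,s)/((t+1)(t+2))` also for `s = t + 1`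
(`t ≤ N`). [folklore] -/
theorem alt_sum_choose_choose_sub_div_succ_succ_of_le_succ (t s N : ℕ) (hst : s ≤ t + 1) (htN : t ≤ N) :
    ∑ j ∈ range (t + 1), (-1 : ℝ) ^ j * (t.choose j : ℝ) * ((N - j).choose s : ℝ) / (((j : ℝ) + 1) * ((j : ℝ) + 2)) =
      ((N + 1).choose s : ℝ) / ((t : ℝ) + 1) - ((N + 2).choose s : ℝ) / (((t : ℝ) + 1) * ((t : ℝ) + 2)) := by
  have ht1 : (t : ℝ) + 1 ≠ 0 := by positivity
  have ht2 : (t : ℝ) + 2 ≠ 0 := by positivity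
  have hterm : ∀ j ∈ range (t + 1),
      (-1 : ℝ) ^ j * (t.choose j : ℝ) * ((N - j).choose s : ℝ) / (((j : ℝ) + 1) * ((j : ℝ) + 2)) =
        (1 / (((t : ℝ) + 1) * ((t : ℝ) + 2))) *
          ((-1 : ℝ) ^ j * ((t + 2).choose (j + 2) : ℝ) * ((N - j).choose s : ℝ)) := by
    intro j _
    have hj1 : (j : ℝ) + 1 ≠ 0 := by positivity
    have hj2 : (j : ℝ) + 2 ≠ 0 := by positivity
    have h1 := Nat.add_one_mul_choose_eq t j
    have h2 := Nat.add_one_mul_choose_eq (t + 1) (j + 1)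
    have h1' : ((t : ℝ) + 1) * (t.choose j : ℝ) = ((t + 1).choose (j + 1) : ℝ) * ((j : ℝ) + 1) := by
      exact_mod_cast h1
    have h2' : ((t : ℝ) + 1 + 1) * ((t + 1).choose (j + 1) : ℝ) =
        ((t + 1 + 1).choose (j + 1 + 1) : ℝ) * ((j : ℝ) + 1 + 1) := by
      exact_mod_cast h2
    have h22 : (t + 1 + 1).choose (j + 1 + 1) = (t + 2).choose (j + 2) := rfl
    rw [h22] at h2'
    have hq : (t.choose j : ℝ) / (((j : ℝ) + 1) * ((j : ℝ) + 2)) =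
        ((t + 2).choose (j + 2) : ℝ) / (((t : ℝ) + 1) * ((t : ℝ) + 2)) := by
      rw [div_eq_div_iff (by positivity) (by positivity)]
      linear_combination ((t : ℝ) + 2) * h1' + ((j : ℝ) + 1) * h2'
    calc (-1 : ℝ) ^ j * (t.choose j : ℝ) * ((N - j).choose s : ℝ) / (((j : ℝ) + 1) * ((j : ℝ) + 2))
        = (-1 : ℝ) ^ j * ((N - j).choose s : ℝ) * ((t.choose j : ℝ) / (((j : ℝ) + 1) * ((j : ℝ) + 2))) := by ring
      _ = (-1 : ℝ) ^ j * ((N - j).choose s : ℝ) * (((t + 2).choose (j + 2) : ℝ) / (((t : ℝ) + 1) * ((t : ℝ) + 2))) := by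
          rw [hq]
      _ = _ := by ring
  rw [Finset.sum_congr rfl hterm, ← Finset.mul_sum]
  have hV := alt_sum_choose_choose_sub (t + 2) s (N + 2) (by omega)
  rw [if_neg (by omega), Finset.sum_range_succ', Finset.sum_range_succ'] at hV
  simp only [pow_zero, Nat.choose_zero_right, Nat.cast_one, one_mul, Nat.sub_zero, zero_add, pow_one,
    Nat.choose_one_right] at hV
  have hshift : ∑ j ∈ range (t + 1), (-1 : ℝ) ^ j * ((t + 2).choose (j + 2) : ℝ) * ((N - j).choose s : ℝ) =
      ∑ j ∈ range (t + 1), (-1 : ℝ) ^ (j + 1 + 1) * ((t + 2).choose (j + 1 + 1) : ℝ) *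
        ((N + 2 - (j + 1 + 1)).choose s : ℝ) := by
    refine Finset.sum_congr rfl fun j _ => ?_
    rw [show N + 2 - (j + 1 + 1) = N - j by omega, pow_succ, pow_succ]
    ring
  rw [hshift]
  have hN21 : N + 2 - 1 = N + 1 := by omega
  rw [hN21] at hV
  have : ∑ j ∈ range (t + 1), (-1 : ℝ) ^ (j + 1 + 1) * ((t + 2).choose (j + 1 + 1) : ℝ) *
      ((N + 2 - (j + 1 + 1)).choose s : ℝ) = ((t + 2 : ℕ) : ℝ) * ((N + 1).choose s : ℝ) - ((N + 2).choose s : ℝ) := by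
    linarith
  rw [this]
  push_cast
  field_simp

/-! ## Per-class values one level higher -/

/-- The per-class value at a class carrying a vertex of a rainbow `T`, for `#T ≤ t + 1`. -/
theorem rbLt_class_value_of_mem_succ (h : Fin m → Fin K) {n t : ℕ} (htn : t + 2 ≤ n) (htK : t + 2 ≤ K)
    {T : Finset (Fin m)} (hinj : Set.InjOn h ↑T) (hT : T.card ≤ t + 1) {i : Fin K} (hi : i ∈ T.image h) :
    (if Set.InjOn h ↑(T.filter fun v => h v ≠ i) then (n : ℝ) ^ (K - (T.filter fun v => h v ≠ i).card) else 0) /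
          (n.choose (T.filter fun v => h v = i).card : ℝ) *
        ∑ j ∈ range (t + 1), (-1 : ℝ) ^ j * ((t : ℝ) + 2) * (t.choose j : ℝ) *
          ((K - 1 - ((T.filter fun v => h v ≠ i).image h).card).choose j : ℝ) *
          ((j + 2).choose (T.filter fun v => h v = i).card : ℝ) /
            (((K : ℝ) + 1) * ((K - 1).choose j : ℝ) * (((j : ℝ) + 1) * ((j : ℝ) + 2))) =
      (n : ℝ) ^ (K - T.card) * (((t : ℝ) + 2) * (K.choose (T.card - 1) : ℝ) /
        (((K : ℝ) + 1) * ((K - 1).choose (T.card - 1) : ℝ) * ((t : ℝ) + 1))) := by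
  classical
  set T' := T.filter fun v => h v ≠ i with hT'
  set Ti := T.filter fun v => h v = i with hTi
  set H := T'.image h with hHdef
  have hinj' : Set.InjOn h ↑T' := hinj.mono (by rw [hT']; exact coe_subset.2 (filter_subset _ _))
  have hH : H.card = T'.card := card_image_of_injOn hinj'
  have hsplit : Ti.card + T'.card = T.card := by
    have := Finset.card_filter_add_card_filter_not (s := T) (fun v => h v = i)
    rw [← hTi] at this
    convert this using 2
  have hn0 : (n : ℝ) ≠ 0 := by
    have : 0 < n := by omega
    positivity
  have hκ : Ti.card = 1 := by
    refine le_antisymm ?_ ?_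
    · exact Finset.card_le_one.2 fun a ha b hb =>
        hinj (mem_coe.2 (mem_filter.1 ha).1) (mem_coe.2 (mem_filter.1 hb).1)
          ((mem_filter.1 ha).2.trans (mem_filter.1 hb).2.symm)
    · obtain ⟨v, hv, hvi⟩ := mem_image.1 hi
      exact Finset.card_pos.2 ⟨v, mem_filter.2 ⟨hv, hvi⟩⟩
  have hT1 : 1 ≤ T.card := by omega
  have hT'card : T'.card = T.card - 1 := by omega
  rw [if_pos hinj', hH, hκ, hT'card]
  simp only [Nat.choose_one_right]
  set s := T.card with hs
  have hsK : s - 1 ≤ K - 1 := by omega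
  have hCKs : ((K - 1).choose (s - 1) : ℝ) ≠ 0 := by
    have := Nat.choose_pos hsK
    positivity
  have hterm : ∀ j ∈ range (t + 1),
      (-1 : ℝ) ^ j * ((t : ℝ) + 2) * (t.choose j : ℝ) * ((K - 1 - (s - 1)).choose j : ℝ) * ((j + 2 : ℕ) : ℝ) /
          (((K : ℝ) + 1) * ((K - 1).choose j : ℝ) * (((j : ℝ) + 1) * ((j : ℝ) + 2))) =
        (((t : ℝ) + 2) / (((K : ℝ) + 1) * ((K - 1).choose (s - 1) : ℝ))) *
          ((-1 : ℝ) ^ j * (t.choose j : ℝ) * ((K - 1 - j).choose (s - 1) : ℝ) / ((j : ℝ) + 1)) := by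
    intro j hj
    have hjt : j < t + 1 := mem_range.1 hj
    have hCKj : ((K - 1).choose j : ℝ) ≠ 0 := by
      have := Nat.choose_pos (show j ≤ K - 1 by omega)
      positivity
    have hj1 : (j : ℝ) + 1 ≠ 0 := by positivity
    have hj2 : (j : ℝ) + 2 ≠ 0 := by positivity
    have hK1 : (K : ℝ) + 1 ≠ 0 := by positivity
    have hex := choose_mul_choose_sub_comm (K - 1) (s - 1) j
    have hex' : ((K - 1 - (s - 1)).choose j : ℝ) =
        ((K - 1).choose j : ℝ) * ((K - 1 - j).choose (s - 1) : ℝ) / ((K - 1).choose (s - 1) : ℝ) := by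
      rw [eq_div_iff hCKs]; linarith
    rw [hex']
    push_cast
    field_simp
  rw [Finset.sum_congr rfl hterm, ← Finset.mul_sum,
    alt_sum_choose_choose_sub_div_succ t (s - 1) (K - 1) (by omega) (by omega),
    show K - 1 + 1 = K by omega]
  have hpow : (n : ℝ) ^ (K - (s - 1)) = (n : ℝ) ^ (K - s) * n := by
    rw [show K - (s - 1) = (K - s) + 1 by omega, pow_succ]
  rw [hpow]
  have ht1 : (t : ℝ) + 1 ≠ 0 := by positivity
  have hK1 : (K : ℝ) + 1 ≠ 0 := by positivity
  field_simp

/-- The per-class value at a class carrying no vertex of a rainbow `T`, for `#T ≤ t + 1`. -/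
theorem rbLt_class_value_of_not_mem_succ (h : Fin m → Fin K) {n t : ℕ} (htK : t + 2 ≤ K)
    {T : Finset (Fin m)} (hinj : Set.InjOn h ↑T) (hT : T.card ≤ t + 1) {i : Fin K} (hi : i ∉ T.image h) :
    (if Set.InjOn h ↑(T.filter fun v => h v ≠ i) then (n : ℝ) ^ (K - (T.filter fun v => h v ≠ i).card) else 0) /
          (n.choose (T.filter fun v => h v = i).card : ℝ) *
        ∑ j ∈ range (t + 1), (-1 : ℝ) ^ j * ((t : ℝ) + 2) * (t.choose j : ℝ) *
          ((K - 1 - ((T.filter fun v => h v ≠ i).image h).card).choose j : ℝ) *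
          ((j + 2).choose (T.filter fun v => h v = i).card : ℝ) /
            (((K : ℝ) + 1) * ((K - 1).choose j : ℝ) * (((j : ℝ) + 1) * ((j : ℝ) + 2))) =
      (n : ℝ) ^ (K - T.card) * (((t : ℝ) + 2) / (((K : ℝ) + 1) * ((K - 1).choose T.card : ℝ)) *
        ((K.choose T.card : ℝ) / ((t : ℝ) + 1) - ((K + 1).choose T.card : ℝ) / (((t : ℝ) + 1) * ((t : ℝ) + 2)))) := by
  classical
  have hTi : (T.filter fun v => h v = i) = ∅ := by
    rw [Finset.filter_eq_empty_iff]
    intro v hv hvi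
    exact hi (mem_image.2 ⟨v, hv, hvi⟩)
  have hT' : (T.filter fun v => h v ≠ i) = T := by
    rw [Finset.filter_eq_self]
    intro v hv hvi
    exact hi (mem_image.2 ⟨v, hv, hvi⟩)
  have hH : (T.image h).card = T.card := card_image_of_injOn hinj
  rw [hTi, hT', if_pos hinj, hH, card_empty]
  simp only [Nat.choose_zero_right, Nat.cast_one, div_one, mul_one]
  set s := T.card with hs
  have hsK : s ≤ K - 1 := by omega
  have hCKs : ((K - 1).choose s : ℝ) ≠ 0 := by
    have := Nat.choose_pos hsK
    positivity
  have hterm : ∀ j ∈ range (t + 1),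
      (-1 : ℝ) ^ j * ((t : ℝ) + 2) * (t.choose j : ℝ) * ((K - 1 - s).choose j : ℝ) /
          (((K : ℝ) + 1) * ((K - 1).choose j : ℝ) * (((j : ℝ) + 1) * ((j : ℝ) + 2))) =
        (((t : ℝ) + 2) / (((K : ℝ) + 1) * ((K - 1).choose s : ℝ))) *
          ((-1 : ℝ) ^ j * (t.choose j : ℝ) * ((K - 1 - j).choose s : ℝ) / (((j : ℝ) + 1) * ((j : ℝ) + 2))) := by
    intro j hj
    have hjt : j < t + 1 := mem_range.1 hj
    have hCKj : ((K - 1).choose j : ℝ) ≠ 0 := by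
      have := Nat.choose_pos (show j ≤ K - 1 by omega)
      positivity
    have hj1 : (j : ℝ) + 1 ≠ 0 := by positivity
    have hj2 : (j : ℝ) + 2 ≠ 0 := by positivity
    have hK1 : (K : ℝ) + 1 ≠ 0 := by positivity
    have hex := choose_mul_choose_sub_comm (K - 1) s j
    have hex' : ((K - 1 - s).choose j : ℝ) =
        ((K - 1).choose j : ℝ) * ((K - 1 - j).choose s : ℝ) / ((K - 1).choose s : ℝ) := by
      rw [eq_div_iff hCKs]; linarith
    rw [hex']
    field_simp
  rw [Finset.sum_congr rfl hterm, ← Finset.mul_sum,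
    alt_sum_choose_choose_sub_div_succ_succ_of_le_succ t s (K - 1) (by omega) (by omega),
    show K - 1 + 1 = K by omega, show K - 1 + 2 = K + 1 by omega]

/-- The per-class value is ZERO at every class when `T` is NOT rainbow, for `#T ≤ t + 1`. -/
theorem rbLt_class_value_of_not_injOn_succ (h : Fin m → Fin K) {n t : ℕ} (htK : t + 2 ≤ K) {T : Finset (Fin m)}
    (hninj : ¬ Set.InjOn h ↑T) (hT : T.card ≤ t + 1) (i : Fin K) :
    (if Set.InjOn h ↑(T.filter fun v => h v ≠ i) then (n : ℝ) ^ (K - (T.filter fun v => h v ≠ i).card) else 0) /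
          (n.choose (T.filter fun v => h v = i).card : ℝ) *
        ∑ j ∈ range (t + 1), (-1 : ℝ) ^ j * ((t : ℝ) + 2) * (t.choose j : ℝ) *
          ((K - 1 - ((T.filter fun v => h v ≠ i).image h).card).choose j : ℝ) *
          ((j + 2).choose (T.filter fun v => h v = i).card : ℝ) /
            (((K : ℝ) + 1) * ((K - 1).choose j : ℝ) * (((j : ℝ) + 1) * ((j : ℝ) + 2))) = 0 := by
  classical
  set T' := T.filter fun v => h v ≠ i with hT'
  set Ti := T.filter fun v => h v = i with hTi
  set H := T'.image h with hHdef
  by_cases hinj' : Set.InjOn h ↑T'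
  · have hcoll : ∃ a ∈ T, ∃ b ∈ T, h a = h b ∧ a ≠ b := by
      by_contra hno
      push Not at hno
      exact hninj fun a ha b hb hab => hno a (mem_coe.1 ha) b (mem_coe.1 hb) hab
    obtain ⟨a, ha, b, hb, hab, hne⟩ := hcoll
    have hai : h a = i := by
      by_contra hai
      have hbi : h b ≠ i := fun hbi => hai (hab.trans hbi)
      exact hne (hinj' (mem_coe.2 (mem_filter.2 ⟨ha, hai⟩)) (mem_coe.2 (mem_filter.2 ⟨hb, hbi⟩)) hab)
    have hbi : h b = i := hab ▸ hai
    have hκ2 : 2 ≤ Ti.card := by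
      have : 1 < Ti.card := Finset.one_lt_card.2 ⟨a, mem_filter.2 ⟨ha, hai⟩, b, mem_filter.2 ⟨hb, hbi⟩, hne⟩
      omega
    have hsplit : Ti.card + T'.card = T.card := by
      have := Finset.card_filter_add_card_filter_not (s := T) (fun v => h v = i)
      rw [← hTi] at this
      convert this using 2
    have hHle : H.card ≤ T'.card := card_image_le
    obtain ⟨r, hr⟩ : ∃ r, Ti.card = r + 2 := ⟨Ti.card - 2, by omega⟩
    rw [hr]
    have hsum : ∑ j ∈ range (t + 1), (-1 : ℝ) ^ j * ((t : ℝ) + 2) * (t.choose j : ℝ) *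
        ((K - 1 - H.card).choose j : ℝ) * ((j + 2).choose (r + 2) : ℝ) /
          (((K : ℝ) + 1) * ((K - 1).choose j : ℝ) * (((j : ℝ) + 1) * ((j : ℝ) + 2))) = 0 := by
      have hCKH : ((K - 1).choose H.card : ℝ) ≠ 0 := by
        have := Nat.choose_pos (show H.card ≤ K - 1 by omega)
        positivity
      have hterm : ∀ j ∈ range (t + 1), (-1 : ℝ) ^ j * ((t : ℝ) + 2) * (t.choose j : ℝ) *
          ((K - 1 - H.card).choose j : ℝ) * ((j + 2).choose (r + 2) : ℝ) /
            (((K : ℝ) + 1) * ((K - 1).choose j : ℝ) * (((j : ℝ) + 1) * ((j : ℝ) + 2))) =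
          (((t : ℝ) + 2) / (((K : ℝ) + 1) * ((K - 1).choose H.card : ℝ) * (((r : ℝ) + 1) * ((r : ℝ) + 2)))) *
            ((-1 : ℝ) ^ j * (t.choose j : ℝ) * (j.choose r : ℝ) * ((K - 1 - j).choose H.card : ℝ)) := by
        intro j hj
        have hjt : j < t + 1 := mem_range.1 hj
        have hCKj : ((K - 1).choose j : ℝ) ≠ 0 := by
          have := Nat.choose_pos (show j ≤ K - 1 by omega)
          positivity
        have hj1 : (j : ℝ) + 1 ≠ 0 := by positivity
        have hj2 : (j : ℝ) + 2 ≠ 0 := by positivity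
        have hr1 : (r : ℝ) + 1 ≠ 0 := by positivity
        have hr2 : (r : ℝ) + 2 ≠ 0 := by positivity
        have hK1 : (K : ℝ) + 1 ≠ 0 := by positivity
        have hex := choose_mul_choose_sub_comm (K - 1) H.card j
        have hex' : ((K - 1 - H.card).choose j : ℝ) =
            ((K - 1).choose j : ℝ) * ((K - 1 - j).choose H.card : ℝ) / ((K - 1).choose H.card : ℝ) := by
          rw [eq_div_iff hCKH]; linarith
        have h22 := choose_add_two_div j r
        rw [div_eq_div_iff (by positivity) (by positivity)] at h22
        have h22' : (((j + 2).choose (r + 2) : ℕ) : ℝ) =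
            ((j.choose r : ℕ) : ℝ) * (((j : ℝ) + 1) * ((j : ℝ) + 2)) / (((r : ℝ) + 1) * ((r : ℝ) + 2)) := by
          rw [eq_div_iff (by positivity)]; linarith
        rw [hex', h22']
        field_simp
      rw [Finset.sum_congr rfl hterm, ← Finset.mul_sum,
        alt_sum_choose_mul_choose_choose_sub t r H.card (K - 1) (by omega) (by omega), mul_zero]
    rw [hsum, mul_zero]
  · rw [if_neg hinj']
    simp

/-- **Inclusion numbers of the level-`t` functional one level higher.** For classes of common size `n ≥ t + 2`, `t + 2 ≤ K`,
and `#T ≤ t + 1`: `L_t(𝟙[T ⊆ ·]) = [T rainbow] · K · n^{K - #T} / (K + 1 - #T)`. [new] -/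
theorem rbLt_indicator_succ (h : Fin m → Fin K) {n t : ℕ} (hn : ∀ c, (cls h c).card = n) (htn : t + 2 ≤ n)
    (htK : t + 2 ≤ K) (T : Finset (Fin m)) (hT : T.card ≤ t + 1) :
    rbLt h n t (fun Q => if T ⊆ Q then 1 else 0) =
      if Set.InjOn h ↑T then (K : ℝ) * (n : ℝ) ^ (K - T.card) / ((K : ℝ) + 1 - T.card) else 0 := by
  classical
  unfold rbLt
  rw [Finset.sum_congr rfl fun i _ => rbLt_class_sum h hn htn (by omega) T i]
  split_ifs with hinj
  · set s := T.card with hs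
    have hH : (T.image h).card = s := card_image_of_injOn hinj
    set X₁ : ℝ := (n : ℝ) ^ (K - s) * (((t : ℝ) + 2) * (K.choose (s - 1) : ℝ) /
        (((K : ℝ) + 1) * ((K - 1).choose (s - 1) : ℝ) * ((t : ℝ) + 1))) with hX₁
    set X₀ : ℝ := (n : ℝ) ^ (K - s) * (((t : ℝ) + 2) / (((K : ℝ) + 1) * ((K - 1).choose s : ℝ)) *
        ((K.choose s : ℝ) / ((t : ℝ) + 1) - ((K + 1).choose s : ℝ) / (((t : ℝ) + 1) * ((t : ℝ) + 2)))) with hX₀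
    have hval : ∀ i : Fin K,
        (if Set.InjOn h ↑(T.filter fun v => h v ≠ i) then (n : ℝ) ^ (K - (T.filter fun v => h v ≠ i).card) else 0) /
              (n.choose (T.filter fun v => h v = i).card : ℝ) *
            ∑ j ∈ range (t + 1), (-1 : ℝ) ^ j * ((t : ℝ) + 2) * (t.choose j : ℝ) *
              ((K - 1 - ((T.filter fun v => h v ≠ i).image h).card).choose j : ℝ) *
              ((j + 2).choose (T.filter fun v => h v = i).card : ℝ) /
                (((K : ℝ) + 1) * ((K - 1).choose j : ℝ) * (((j : ℝ) + 1) * ((j : ℝ) + 2))) =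
          if i ∈ T.image h then X₁ else X₀ := by
      intro i
      by_cases hi : i ∈ T.image h
      · rw [if_pos hi]; exact rbLt_class_value_of_mem_succ h htn htK hinj hT hi
      · rw [if_neg hi]; exact rbLt_class_value_of_not_mem_succ h htK hinj hT hi
    rw [Finset.sum_congr rfl fun i _ => hval i, Finset.sum_ite, Finset.sum_const, Finset.sum_const, nsmul_eq_mul,
      nsmul_eq_mul]
    have hc1 : ((univ : Finset (Fin K)).filter fun i => i ∈ T.image h) = T.image h := by
      ext i; simp
    have hc0 : (((univ : Finset (Fin K)).filter fun i => ¬ i ∈ T.image h).card : ℝ) = (K : ℝ) - s := by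
      have : ((univ : Finset (Fin K)).filter fun i => ¬ i ∈ T.image h) = univ \ T.image h := by
        ext i; simp
      rw [this, card_sdiff_of_subset (subset_univ _), card_univ, Fintype.card_fin, hH, Nat.cast_sub (by omega)]
    rw [hc1, hH, hc0, hX₁, hX₀]
    have hsK : s ≤ K - 1 := by omega
    have hCKs : ((K - 1).choose s : ℝ) ≠ 0 := by
      have := Nat.choose_pos hsK; positivity
    have ht1 : (t : ℝ) + 1 ≠ 0 := by positivity
    have ht2 : (t : ℝ) + 2 ≠ 0 := by positivity
    have hK1' : (K : ℝ) + 1 ≠ 0 := by positivity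
    have hKs : (K : ℝ) - s ≠ 0 := by
      have : (s : ℝ) + 1 ≤ K := by exact_mod_cast (show s + 1 ≤ K by omega)
      intro h0; linarith
    have hKs1 : (K : ℝ) + 1 - s ≠ 0 := by
      have : (s : ℝ) + 1 ≤ K := by exact_mod_cast (show s + 1 ≤ K by omega)
      intro h0; linarith
    have hr2 : (K.choose s : ℝ) * ((K : ℝ) - s) = (K : ℝ) * ((K - 1).choose s : ℝ) := by
      have := Nat.choose_mul_succ_eq (K - 1) s
      rw [show K - 1 + 1 = K by omega] at this
      have h' : (((K - 1).choose s : ℕ) : ℝ) * (K : ℝ) = ((K.choose s : ℕ) : ℝ) * ((K - s : ℕ) : ℝ) := by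
        exact_mod_cast this
      rw [Nat.cast_sub (by omega)] at h'
      linarith
    have hr3 : ((K + 1).choose s : ℝ) * ((K : ℝ) + 1 - s) = ((K : ℝ) + 1) * (K.choose s : ℝ) := by
      have := Nat.choose_mul_succ_eq K s
      have h' : ((K.choose s : ℕ) : ℝ) * ((K + 1 : ℕ) : ℝ) = (((K + 1).choose s : ℕ) : ℝ) * ((K + 1 - s : ℕ) : ℝ) := by
        exact_mod_cast this
      rw [Nat.cast_sub (by omega)] at h'
      push_cast at h'
      linarith
    have e2 : (K.choose s : ℝ) = (K : ℝ) * ((K - 1).choose s : ℝ) / ((K : ℝ) - s) := by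
      rw [eq_div_iff hKs]; exact hr2
    have e3 : ((K + 1).choose s : ℝ) = ((K : ℝ) + 1) * (K.choose s : ℝ) / ((K : ℝ) + 1 - s) := by
      rw [eq_div_iff hKs1]; exact hr3
    rcases Nat.eq_zero_or_pos s with hs0 | hs0
    · rw [hs0] at e2 e3 ⊢
      rw [e3, e2]
      simp only [Nat.cast_zero, sub_zero, Nat.sub_zero, zero_mul, zero_add]
      field_simp
      ring
    · have hCKs1 : ((K - 1).choose (s - 1) : ℝ) ≠ 0 := by
        have := Nat.choose_pos (show s - 1 ≤ K - 1 by omega); positivity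
      have hKs1' : (K : ℝ) - s + 1 ≠ 0 := by
        have : (s : ℝ) + 1 ≤ K := by exact_mod_cast (show s + 1 ≤ K by omega)
        intro h0; linarith
      have hr1 : (K.choose (s - 1) : ℝ) * ((K : ℝ) - s + 1) = (K : ℝ) * ((K - 1).choose (s - 1) : ℝ) := by
        have := Nat.choose_mul_succ_eq (K - 1) (s - 1)
        rw [show K - 1 + 1 = K by omega] at this
        have h' : (((K - 1).choose (s - 1) : ℕ) : ℝ) * (K : ℝ) =
            ((K.choose (s - 1) : ℕ) : ℝ) * ((K - (s - 1) : ℕ) : ℝ) := by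
          exact_mod_cast this
        rw [Nat.cast_sub (by omega), Nat.cast_sub (by omega)] at h'
        push_cast at h'
        linarith
      have e1 : (K.choose (s - 1) : ℝ) = (K : ℝ) * ((K - 1).choose (s - 1) : ℝ) / ((K : ℝ) - s + 1) := by
        rw [eq_div_iff hKs1']; exact hr1
      rw [e3, e2, e1]
      field_simp
      ring
  · exact Finset.sum_eq_zero fun i _ => rbLt_class_value_of_not_injOn_succ h htK hinj hT i

/-- **Registered helper stub (inclusion numbers of the level-`t` functional one level higher).** Restatement of
`rbLt_indicator_succ` with all parameters explicit. -/
theorem rainbow_marginal_level_succ : ∀ {m K n t : ℕ} (h : Fin m → Fin K), (∀ c, (cls h c).card = n) → t + 2 ≤ n → t + 2 ≤ K → ∀ (T : Finset (Fin m)), T.card ≤ t + 1 → rbLt h n t (fun Q => if T ⊆ Q then 1 else 0) = if Set.InjOn h ↑T then (K : ℝ) * (n : ℝ) ^ (K - T.card) / ((K : ℝ) + 1 - T.card) else 0 := by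
  intro m K n t h hn htn htK T hT
  exact rbLt_indicator_succ h hn htn htK T hT

end

end Summit.PneNP.PneNP.Theorems
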